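import Summits.Ventures.CertifiedManyBodySolver.Downfold.EmeryBandJetWindow
import Summits.Ventures.CertifiedManyBodySolver.Downfold.EmeryFermiFillingHg1201Subs
import Summits.Ventures.CertifiedManyBodySolver.Downfold.EmeryFermiEnergyExistsAll
import HarnessLib

/-!
# THE WHOLE-BAND (OBJECT-M) ONE-BAND SET AS CERTIFIED WINDOWS — HgBa₂CuO₄ at P = 0, n_H = 1.125 (ν = 7/16), sub-boxes 2_1: for EVERY member of each Δ_pd × t_pd sub-box the
# nodal-jet `(t_J, t′_J/t_J, t″_J/t_J)` of `EmeryBandJet` at the Fermi energy lies in the tabulated windows (INFL-3to1-B §B.101)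

Venture CertifiedManyBodySolver, cell `pub/hubbard-downfold` (stage S1; INFLATION-RULES-3to1-B §B.101), seat hubbard-downfold-mod-4 (technique B = band
level, g45); namespace `Summit.Ventures.CertifiedManyBodySolver.Downfold.Emery`. Everything PROVED (`decide +kernel` on the bisection certificates of
`EmeryBandJetWindow.jetLeaf` — slope arithmetic `EmerySlopeArith(Sound)` — composed with the sub-box ε_F brackets of `EmeryFermiFillingHg1201Subs` and
`abFilling_fermiEnergyOf'`; generator HOME/hubbard-downfold-mod-4/jet-g45/gen/emit_boxes2.py, bit-exact python mirror of the kernel checker).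
WHAT THIS IS NOT: a statement about HgBa₂CuO₄ at P = 0 — the typed box (box #19's σ companion `emeryBoxHg1201v114` (HgBa₂CuO₄ at P = 0; Δ_pd [1.4, 2.5] × t_pd [1.12, 1.32] × t_pp [0.64, 0.85] × t_pp′ [0.111, 0.208] eV)) is SCREENING-GRADE; `U = 0` one-body kinematics of the σ model; the ε_F coupling is per
SUB-BOX (each member's jet is bounded over its sub-box's certified ε_F bracket, not at its own ε_F), so the windows are OUTER bounds of the true ranges.

| Δ_pd | t_pd | ε_F bracket | leaf evaluations | t_J (eV) | t′_J/t_J | t″_J/t_J |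
|---|---|---|---|---|---|---|
| [1.95, 2.225] | [1.22, 1.32] | [1.28, 2.08] | 537 | [0.3287, 0.5246] | [-0.2038, -0.0442] | [0.0605, 0.2699] |

Sources: [HybertsenSchluterChristensen1989, Eq. (1)]; [AndersenEtAl1995, §6]; [PavariniEtAl2001, Eq. (1)]; interval/slope arithmetic [folklore].
-/

noncomputable section

namespace Summit.Ventures.CertifiedManyBodySolver.Downfold.Emery

open Real Set Literature.Analysis.ValidatedNumerics.Numerics

/-! ## Bisection certificates (one `decide +kernel` per piece of the bisection tree) -/

set_option maxRecDepth 16384 in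
/-- Sub-box 2_1, piece 4 (h4l4; 91 leaf evaluations). [folklore] -/
theorem hg1201P0Jet_2_1_c4 :
    Box5.deep (jetLeaf ⟨92520824844792, 147661772782411, -57364600253632, -12441193970610, 17029236090994, 75970096214207⟩) 40
      ⟨fiIcc 39 20 89 40, fiIcc 61 50 33 25, fiIcc 16 25 17 20, fiIcc 111 1000 26 125, Box5.loHalf (Box5.hiHalf (fiIcc 32 25 52 25))⟩ = true := by
  decide +kernel

set_option maxRecDepth 16384 in
/-- Sub-box 2_1, piece 5 (h4h4; 83 leaf evaluations). [folklore] -/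
theorem hg1201P0Jet_2_1_c5 :
    Box5.deep (jetLeaf ⟨92520824844792, 147661772782411, -57364600253632, -12441193970610, 17029236090994, 75970096214207⟩) 40
      ⟨fiIcc 39 20 89 40, fiIcc 61 50 33 25, fiIcc 16 25 17 20, fiIcc 111 1000 26 125, Box5.hiHalf (Box5.hiHalf (fiIcc 32 25 52 25))⟩ = true := by
  decide +kernel

end Summit.Ventures.CertifiedManyBodySolver.Downfold.Emery
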